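import Summits.AtomisticToContinuum.HydrodynamicLimit.Theorems.AntiMazurCoboundariesKineticWindowGronwallWindowSubadditivity
import Summits.AtomisticToContinuum.HydrodynamicLimit.Theorems.AntiMazurCoboundariesKineticWindowGronwallRenyiHolderTransfer
import Summits.AtomisticToContinuum.HydrodynamicLimit.Theorems.BoltzmannGreenKubo.Negative.JointMeasurability
import Literature.MathematicalPhysics.KineticTheory.HardSphereWindowPressureStatic
import HarnessLib

/-!
# The window clause from Rényi quasi-invariance (helper stub `stub_windowClauseOfRenyi`, line `board-node-dock`)

Crux `Summit.AtomisticToContinuum.HydrodynamicLimit.Theses.AntiMazurCoboundaries.KineticWindowGronwall`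
(stmt-AtomisticToContinuum-9282), line `board-node-dock` (lead c6), toolkit for content (iii) — the window clause
`∃ τ₀ ∀ τ ≥ τ₀` — of the local kinetic node `KineticWindowLDBoundsUniform`. Under an INVARIANT law the upgrade
"one window ⟹ all longer windows" is `…KineticWindowGronwallWindowSubadditivity`; the local Gibbs laws
`λ_N = ψ_N · Liouville` are NOT flow invariant, and here invariance is replaced by the order-`p` Rényi
quasi-invariance hypothesis (R) `∫ (ψ_N ∘ Φ_{-s} / ψ_N)^p dλ_N ≤ e^{ε(N+1)}` over kinetic windows plus Hölder.

PROOF (`stub_windowClauseOfRenyi`). Given `τ ≥ τ₀ > 0` put `k = ⌊τ/τ₀⌋₊ ≥ 1`, `τ' = τ/k ∈ [τ₀, 2τ₀]`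
(`exists_subwindows`); at size `N` the window `w = k w'`, `w' = τ'(N+1)^{-1/3}`. On good orbits the window
functional is the Cesàro average `k⁻¹ Σ_{j<k} Y(Φ_{jw'} z)` of the one-window functional `Y` (landed
`KineticWindowGronwallWindowSubadditivity.window_eq_cesaro`, `iterate_flow_apply`; `Y` is replaced by its
measurable modification `Ymod` built on the jointly measurable modified flow `BoltzmannGreenKuboOrthMomentum.flowMod`,
which agrees with `Y` on the good set, an invariant set of full `λ_N`-measure), so
`exp(β · window) = Π_j (exp Y(Φ_{jw'} z))^{1/k}` and the generalised Hölder inequality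
`ENNReal.lintegral_prod_norm_pow_le` bounds the window moment by `Π_j (∫ exp Y ∘ Φ_{jw'} dλ_N)^{1/k}`. Each factor
is transferred back to time `0` along the Liouville-preserving flow (the landed helper
`KineticWindowGronwallRenyiHolderTransfer.stub_renyiHolderTransfer`:
`∫ H ∘ Φ_s dλ ≤ (∫ (ψ∘Φ_{-s}/ψ)^p dλ)^{1/p} (∫ H^q dλ)^{1/q}`, applicable because `ψ_N > 0` Liouville-a.e. for data
`a, θ₀ > 0` — if the partition function vanishes the law is `0` and everything is trivial), and
`∫ H^q dλ_N` is the window moment at window `τ'` and tilt `qβ`, `|qβ| ≤ b`, bounded by hypothesis (W); the Rényi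
factor is bounded by (R) since `0 ≤ jw' ≤ w`. As `1/p + 1/q = 1` every factor is `≤ e^{ε(N+1)}`, hence so is
the window moment. Folklore (Hölder along a quasi-invariant reference measure); no named fact is used.
-/

noncomputable section

namespace Summit.AtomisticToContinuum.HydrodynamicLimit.Theorems.KineticWindowGronwallWindowClauseOfRenyi

open _root_.MeasureTheory _root_.Set _root_.Filter
open scoped _root_.ENNReal
open Literature.Analysis.FluidPDE Literature.MathematicalPhysics.KineticTheory

/-- The hard-sphere flow of `N+1` spheres at reduced density `σ` on `𝕋³`. -/
abbrev TFlow (σ : ℝ) (N : ℕ) : Type :=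
  HardSphereFlow (Torus.geometry (Fin 3)) (hsDiameter σ N) (N + 1)

/-- The Liouville measure of `N+1` spheres at reduced density `σ` on `𝕋³`. -/
abbrev liou (σ : ℝ) (N : ℕ) : Measure (Config (N + 1) (Fin 3) T3) :=
  liouville (Torus.geometry (Fin 3)) (N + 1) (hsDiameter σ N)

/-- The local Gibbs DENSITY with respect to the Liouville measure (the canonical density of the local Gibbs profile,
as an extended nonnegative real): `localGibbsLaw σ a u₀ θ₀ N Φ = (liou σ N).withDensity (lgDensity σ a θ₀ u₀ N)`. -/
def lgDensity (σ : ℝ) (a θ₀ : T3 → ℝ) (u₀ : T3 → V3) (N : ℕ) (z : Config (N + 1) (Fin 3) T3) : ℝ≥0∞ :=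
  ENNReal.ofReal (canonicalDensity (Torus.geometry (Fin 3)) (hsDiameter σ N) (N + 1) (localGibbsProfile a u₀ θ₀) z)

/-- The window exponential moment of the node, at window parameter `τ`, tilt `β`, one-body functional `F`. -/
def windowMoment (σ : ℝ) (a θ₀ : T3 → ℝ) (u₀ : T3 → V3) (Φ : (N : ℕ) → TFlow σ N) (F : T3 × V3 → ℝ)
    (N : ℕ) (τ β : ℝ) : ℝ≥0∞ :=
  ∫⁻ z, ENNReal.ofReal (Real.exp (β * ∑ i : Fin (N + 1),
      (τ * ((N : ℝ) + 1) ^ (-(1 / 3 : ℝ)))⁻¹ *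
        ∫ r in (0 : ℝ)..(τ * ((N : ℝ) + 1) ^ (-(1 / 3 : ℝ))), F (((Φ N).flow r z) i)))
    ∂(localGibbsLaw σ a u₀ θ₀ N (Φ N))

/-- **Helper statement `WindowClauseOfRenyi`** (pointwise in the datum; continuous data with `a, θ₀ > 0`, so that the local Gibbs
density is Liouville-a.e. positive and the Rényi integral below is the true order-`p` Rényi divergence): IF the local Gibbs laws of
a datum are order-`p` Rényi quasi-invariant over kinetic windows along the flow family, THEN the window bound on ONE band of windows
`τ ∈ [τ₀, 2τ₀]` at tilt radius `b` upgrades to ALL windows `τ ≥ τ₀` at tilt radius `b/q` (`q` conjugate to `p`):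
split `[0, kw]` into `k` shifted sub-windows, generalised Hölder with `k` factors, transfer each shifted factor back to
time `0` by `RenyiHolderTransfer`. -/
def WindowClauseOfRenyi : Prop :=
  ∀ (σ : ℝ) (a θ₀ : T3 → ℝ) (u₀ : T3 → V3), Continuous a → Continuous θ₀ → Continuous u₀ →
    (∀ x, 0 < a x) → (∀ x, 0 < θ₀ x) →
    ∀ (Φ : (N : ℕ) → TFlow σ N) (F : T3 × V3 → ℝ), Continuous F →
    ∀ (p q : ℝ), p.HolderConjugate q →
    (∀ τ ε : ℝ, 0 < τ → 0 < ε → ∃ N₀ : ℕ, ∀ N : ℕ, N₀ ≤ N → ∀ s : ℝ, 0 ≤ s →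
        s ≤ τ * ((N : ℝ) + 1) ^ (-(1 / 3 : ℝ)) →
        ∫⁻ z, (lgDensity σ a θ₀ u₀ N ((Φ N).flow (-s) z) / lgDensity σ a θ₀ u₀ N z) ^ p
            ∂(localGibbsLaw σ a u₀ θ₀ N (Φ N)) ≤ ENNReal.ofReal (Real.exp (ε * ((N : ℝ) + 1)))) →
    ∀ (b τ₀ : ℝ), 0 < τ₀ →
    (∀ β : ℝ, |β| ≤ b → ∀ ε : ℝ, 0 < ε → ∀ τ ∈ Icc τ₀ (2 * τ₀), ∃ N₀ : ℕ, ∀ N : ℕ, N₀ ≤ N →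
        windowMoment σ a θ₀ u₀ Φ F N τ β ≤ ENNReal.ofReal (Real.exp (ε * ((N : ℝ) + 1)))) →
    ∀ β : ℝ, |β| ≤ b / q → ∀ ε : ℝ, 0 < ε → ∀ τ : ℝ, τ₀ ≤ τ → ∃ N₀ : ℕ, ∀ N : ℕ, N₀ ≤ N →
        windowMoment σ a θ₀ u₀ Φ F N τ β ≤ ENNReal.ofReal (Real.exp (ε * ((N : ℝ) + 1)))

/-! ### The local Gibbs density: measurability, a.e. positivity, the degenerate case -/

/-- The local Gibbs density of continuous data is measurable. [folklore] -/
theorem measurable_lgDensity (σ : ℝ) {a θ₀ : T3 → ℝ} {u₀ : T3 → V3} (ha : Continuous a) (hθ : Continuous θ₀)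
    (hu : Continuous u₀) (N : ℕ) : Measurable (lgDensity σ a θ₀ u₀ N) :=
  ENNReal.measurable_ofReal.comp (measurable_canonicalDensity _ _ (measurable_localGibbsProfile ha hθ hu))

/-- For data `a, θ₀ > 0` with positive partition function the local Gibbs density is Liouville-a.e. nonzero
(it is positive on the hard-sphere domain, which carries the Liouville measure). [folklore] -/
theorem ae_lgDensity_ne_zero (σ : ℝ) {a θ₀ : T3 → ℝ} (u₀ : T3 → V3) (ha0 : ∀ x, 0 < a x) (hθ0 : ∀ x, 0 < θ₀ x)
    (N : ℕ) (hZ : 0 < canonicalPartition (Torus.geometry (Fin 3)) (hsDiameter σ N) (N + 1) (localGibbsProfile a u₀ θ₀)) :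
    ∀ᵐ z ∂(liou σ N), lgDensity σ a θ₀ u₀ N z ≠ 0 := by
  have hD : MeasurableSet (hardSphereDomain (Torus.geometry (Fin 3)) (N + 1) (hsDiameter σ N)) :=
    measurableSet_hardSphereDomain _ Torus.measurable_geometry_sepVec _ _
  have hmem : ∀ᵐ z ∂(liou σ N), z ∈ hardSphereDomain (Torus.geometry (Fin 3)) (N + 1) (hsDiameter σ N) :=
    ae_restrict_mem hD
  filter_upwards [hmem] with z hz
  rw [lgDensity, Ne, ENNReal.ofReal_eq_zero, not_le, canonicalDensity, Set.indicator_of_mem hz, tensorPow]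
  exact mul_pos (inv_pos.mpr hZ)
    (Finset.prod_pos fun i _ => mul_pos (ha0 _) (localMaxwellian_pos one_pos (hθ0 _) _ _))

/-- If the partition function vanishes, the local Gibbs law is the zero measure. [folklore] -/
theorem localGibbsLaw_eq_zero_of_partition (σ : ℝ) (a θ₀ : T3 → ℝ) (u₀ : T3 → V3) (N : ℕ) (Φ : TFlow σ N)
    (hZ : canonicalPartition (Torus.geometry (Fin 3)) (hsDiameter σ N) (N + 1) (localGibbsProfile a u₀ θ₀) = 0) :
    localGibbsLaw σ a u₀ θ₀ N Φ = 0 := by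
  have h : lgDensity σ a θ₀ u₀ N = 0 := by
    funext z
    simp [lgDensity, canonicalDensity, hZ]
  change (liou σ N).withDensity (lgDensity σ a θ₀ u₀ N) = 0
  rw [h, withDensity_zero]

/-- The local Gibbs law is carried by the good set of every flow (it is absolutely continuous with respect to the
Liouville measure). [folklore] -/
theorem ae_mem_good_lgl (σ : ℝ) (a θ₀ : T3 → ℝ) (u₀ : T3 → V3) (N : ℕ) (Φ : TFlow σ N) :
    ∀ᵐ z ∂(localGibbsLaw σ a u₀ θ₀ N Φ), z ∈ Φ.good :=
  (withDensity_absolutelyContinuous (liou σ N) (lgDensity σ a θ₀ u₀ N)).ae_le Φ.ae_mem_good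

/-! ### Window functionals: the measurable modification and the Cesàro identity -/

/-- The tilted one-window functional `β Σᵢ w⁻¹ ∫₀ʷ F((Φ_r z)ᵢ) dr` computed along the MODIFIED flow
`BoltzmannGreenKuboOrthMomentum.flowMod` (jointly measurable, equal to the flow at good data). -/
def Ymod {σ : ℝ} {N : ℕ} (Φ : TFlow σ N) (F : T3 × V3 → ℝ) (w β : ℝ) (z : Config (N + 1) (Fin 3) T3) : ℝ :=
  β * ∑ i : Fin (N + 1), w⁻¹ * ∫ r in (0 : ℝ)..w, F ((BoltzmannGreenKuboOrthMomentum.flowMod Φ (r, z)) i)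

/-- `Ymod` is measurable for a continuous one-body observable (Fubini measurability of window functionals of a
jointly measurable integrand). [folklore] -/
theorem measurable_Ymod {σ : ℝ} {N : ℕ} (Φ : TFlow σ N) {F : T3 × V3 → ℝ} (hF : Continuous F) (w β : ℝ) :
    Measurable (Ymod Φ F w β) := by
  unfold Ymod
  refine Measurable.const_mul (Finset.measurable_sum _ fun i _ => Measurable.const_mul ?_ _) _
  have hFi : Measurable fun z : Config (N + 1) (Fin 3) T3 => F (z i) := (hF.comp (continuous_apply i)).measurable
  exact KineticWindowGronwallWindowSubadditivity.measurable_intervalIntegral_right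
    (f := fun r z => F ((BoltzmannGreenKuboOrthMomentum.flowMod Φ (r, z)) i))
    (hFi.comp (BoltzmannGreenKuboOrthMomentum.measurable_flowMod Φ)) 0 w

/-- At a good datum `Ymod` is the true tilted one-window functional. [folklore] -/
theorem Ymod_eq {σ : ℝ} {N : ℕ} (Φ : TFlow σ N) (F : T3 × V3 → ℝ) (w β : ℝ) {z : Config (N + 1) (Fin 3) T3}
    (hz : z ∈ Φ.good) :
    Ymod Φ F w β z = β * ∑ i : Fin (N + 1), w⁻¹ * ∫ r in (0 : ℝ)..w, F ((Φ.flow r z) i) := by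
  simp only [Ymod, BoltzmannGreenKuboOrthMomentum.flowMod_of_mem Φ hz]

/-- **Cesàro identity on good orbits.** The tilted window functional over `[0, k w]` is the average of the
one-window functionals shifted by `j w`, `j < k`:
`β Σᵢ (kw)⁻¹ ∫₀^{kw} F((Φ_r z)ᵢ) dr = k⁻¹ Σ_{j<k} Ymod(Φ_{jw} z)`. [folklore] -/
theorem window_cesaro_sum {σ : ℝ} {N : ℕ} (Φ : TFlow σ N) {F : T3 × V3 → ℝ} (hF : Continuous F)
    {z : Config (N + 1) (Fin 3) T3} (hz : z ∈ Φ.good) (w β : ℝ) (k : ℕ) :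
    β * ∑ i : Fin (N + 1), ((k : ℝ) * w)⁻¹ * ∫ r in (0 : ℝ)..((k : ℝ) * w), F ((Φ.flow r z) i) =
      (k : ℝ)⁻¹ * ∑ j ∈ Finset.range k, Ymod Φ F w β (Φ.flow ((j : ℝ) * w) z) := by
  have hi : ∀ i : Fin (N + 1), ((k : ℝ) * w)⁻¹ * ∫ r in (0 : ℝ)..((k : ℝ) * w), F ((Φ.flow r z) i) =
      (k : ℝ)⁻¹ * ∑ j ∈ Finset.range k, w⁻¹ * ∫ r in (0 : ℝ)..w, F ((Φ.flow r (Φ.flow ((j : ℝ) * w) z)) i) := by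
    intro i
    have h := KineticWindowGronwallWindowSubadditivity.window_eq_cesaro Φ (fun y => F (y i)) hz
      (fun a b => Φ.intervalIntegrable_comp_flow_of_continuous hz (hF.comp (continuous_apply i)) a b) w k
    rw [h]
    refine congrArg _ (Finset.sum_congr rfl fun j _ => ?_)
    rw [KineticWindowGronwallWindowSubadditivity.iterate_flow_apply Φ hz w j]
  have hY : ∀ j ∈ Finset.range k, Ymod Φ F w β (Φ.flow ((j : ℝ) * w) z) =
      β * ∑ i : Fin (N + 1), w⁻¹ * ∫ r in (0 : ℝ)..w, F ((Φ.flow r (Φ.flow ((j : ℝ) * w) z)) i) :=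
    fun j _ => Ymod_eq Φ F w β (Φ.mapsTo_good _ hz)
  rw [Finset.sum_congr rfl hY, Finset.sum_congr rfl fun i _ => hi i]
  simp only [Finset.mul_sum]
  rw [Finset.sum_comm]
  exact Finset.sum_congr rfl fun j _ => Finset.sum_congr rfl fun i _ => by ring

/-- Pointwise: the exponential of a Cesàro average is the product of the `k`-th roots,
`exp(k⁻¹ Σ_{j<k} Yⱼ) = Πⱼ (exp Yⱼ)^{1/k}` in `ℝ≥0∞`. [folklore] -/
theorem ofReal_exp_inv_mul_sum (k : ℕ) (Y : ℕ → ℝ) :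
    ENNReal.ofReal (Real.exp ((k : ℝ)⁻¹ * ∑ j ∈ Finset.range k, Y j)) =
      ∏ j ∈ Finset.range k, ENNReal.ofReal (Real.exp (Y j)) ^ (k : ℝ)⁻¹ := by
  rw [Finset.mul_sum, Real.exp_sum, ENNReal.ofReal_prod_of_nonneg fun j _ => (Real.exp_pos _).le]
  exact Finset.prod_congr rfl fun j _ =>
    KineticWindowGronwallWindowSubadditivity.ofReal_exp_mul_left _ _ (inv_nonneg.mpr (Nat.cast_nonneg k))

/-! ### The window moment at a free window length, and the one-size estimate -/

/-- The window exponential moment at a FREE window length `w` (so that `windowMoment … N τ β` is `ewm` at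
`w = τ (N+1)^{-1/3}`, definitionally). -/
def ewm (σ : ℝ) (a θ₀ : T3 → ℝ) (u₀ : T3 → V3) (N : ℕ) (Φ : TFlow σ N) (F : T3 × V3 → ℝ) (w β : ℝ) : ℝ≥0∞ :=
  ∫⁻ z, ENNReal.ofReal (Real.exp (β * ∑ i : Fin (N + 1), w⁻¹ * ∫ r in (0 : ℝ)..w, F ((Φ.flow r z) i)))
    ∂(localGibbsLaw σ a u₀ θ₀ N Φ)

/-- `windowMoment` is `ewm` at the kinetic window `τ (N+1)^{-1/3}`. [folklore] -/
theorem windowMoment_eq_ewm (σ : ℝ) (a θ₀ : T3 → ℝ) (u₀ : T3 → V3) (Φ : (N : ℕ) → TFlow σ N) (F : T3 × V3 → ℝ)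
    (N : ℕ) (τ β : ℝ) :
    windowMoment σ a θ₀ u₀ Φ F N τ β = ewm σ a θ₀ u₀ N (Φ N) F (τ * ((N : ℝ) + 1) ^ (-(1 / 3 : ℝ))) β := rfl

/-- **The one-size estimate.** For continuous data with `a, θ₀ > 0`, a flow `Φ`, a continuous one-body `F`,
conjugate `p, q`, `0 < k`, `0 ≤ w`: if the Rényi integrals at all shifts `0 ≤ s ≤ k w` and the window moment at
window `w` and tilt `qβ` are `≤ E`, then the window moment at window `k w` and tilt `β` is `≤ E`
(Cesàro identity, generalised Hölder, Hölder transfer of each factor, `1/p + 1/q = 1`). [folklore] -/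
theorem ewm_mul_le {σ : ℝ} {a θ₀ : T3 → ℝ} {u₀ : T3 → V3} (ha : Continuous a) (hθ : Continuous θ₀)
    (hu : Continuous u₀) (ha0 : ∀ x, 0 < a x) (hθ0 : ∀ x, 0 < θ₀ x) {N : ℕ} (Φ : TFlow σ N) {F : T3 × V3 → ℝ}
    (hF : Continuous F) {p q : ℝ} (hpq : p.HolderConjugate q) {k : ℕ} (hk : 0 < k) {w : ℝ} (hw : 0 ≤ w) (β : ℝ)
    {E : ℝ≥0∞}
    (hR : ∀ s : ℝ, 0 ≤ s → s ≤ (k : ℝ) * w →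
      ∫⁻ z, (lgDensity σ a θ₀ u₀ N (Φ.flow (-s) z) / lgDensity σ a θ₀ u₀ N z) ^ p
        ∂(localGibbsLaw σ a u₀ θ₀ N Φ) ≤ E)
    (hW : ewm σ a θ₀ u₀ N Φ F w (q * β) ≤ E) :
    ewm σ a θ₀ u₀ N Φ F ((k : ℝ) * w) β ≤ E := by
  rcases (canonicalPartition_nonneg (Torus.geometry (Fin 3)) (hsDiameter σ N) (N + 1)
    (f := localGibbsProfile a u₀ θ₀)
    fun y => localGibbsProfile_nonneg (fun x => (ha0 x).le) (fun x => (hθ0 x).le) y).eq_or_lt with hZ | hZ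
  · -- degenerate case: the law is the zero measure
    rw [ewm, localGibbsLaw_eq_zero_of_partition σ a θ₀ u₀ N Φ hZ.symm, lintegral_zero_measure]
    exact zero_le
  have hlaw : localGibbsLaw σ a u₀ θ₀ N Φ = (liou σ N).withDensity (lgDensity σ a θ₀ u₀ N) := rfl
  have hψm : Measurable (lgDensity σ a θ₀ u₀ N) := measurable_lgDensity σ ha hθ hu N
  have hψ0 : ∀ᵐ z ∂(liou σ N), lgDensity σ a θ₀ u₀ N z ≠ 0 := ae_lgDensity_ne_zero σ u₀ ha0 hθ0 N hZ
  have hgood : ∀ᵐ z ∂(localGibbsLaw σ a u₀ θ₀ N Φ), z ∈ Φ.good := ae_mem_good_lgl σ a θ₀ u₀ N Φ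
  have hHm : Measurable fun z => ENNReal.ofReal (Real.exp (Ymod Φ F w β z)) :=
    (measurable_Ymod Φ hF w β).exp.ennreal_ofReal
  have hk0 : (0 : ℝ) ≤ (k : ℝ)⁻¹ := inv_nonneg.mpr (Nat.cast_nonneg k)
  have hsum : ∑ _j ∈ Finset.range k, (k : ℝ)⁻¹ = 1 := by
    rw [Finset.sum_const, Finset.card_range, nsmul_eq_mul, mul_inv_cancel₀ (Nat.cast_ne_zero.mpr hk.ne')]
  have hq0 : 0 ≤ q := hpq.symm.nonneg
  -- the `q`-th power of the transferred observable is the window moment at tilt `qβ`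
  have hHq : ∫⁻ z, (ENNReal.ofReal (Real.exp (Ymod Φ F w β z))) ^ q ∂(localGibbsLaw σ a u₀ θ₀ N Φ) =
      ewm σ a θ₀ u₀ N Φ F w (q * β) := by
    unfold ewm
    refine lintegral_congr_ae (hgood.mono fun z hz => ?_)
    dsimp only
    rw [← KineticWindowGronwallWindowSubadditivity.ofReal_exp_mul_left q _ hq0, Ymod_eq Φ F w β hz, mul_assoc]
  -- each shifted factor is at most `E`
  have hfac : ∀ j ∈ Finset.range k,
      ∫⁻ z, ENNReal.ofReal (Real.exp (Ymod Φ F w β (Φ.flow ((j : ℝ) * w) z))) ∂(localGibbsLaw σ a u₀ θ₀ N Φ) ≤ E := by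
    intro j hj
    have hjk : (j : ℝ) ≤ k := by exact_mod_cast (Finset.mem_range.mp hj).le
    have hs0 : 0 ≤ (j : ℝ) * w := mul_nonneg (Nat.cast_nonneg j) hw
    have hs1 : (j : ℝ) * w ≤ (k : ℝ) * w := mul_le_mul_of_nonneg_right hjk hw
    calc ∫⁻ z, ENNReal.ofReal (Real.exp (Ymod Φ F w β (Φ.flow ((j : ℝ) * w) z))) ∂(localGibbsLaw σ a u₀ θ₀ N Φ)
        ≤ (∫⁻ z, (lgDensity σ a θ₀ u₀ N (Φ.flow (-((j : ℝ) * w)) z) / lgDensity σ a θ₀ u₀ N z) ^ p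
              ∂(localGibbsLaw σ a u₀ θ₀ N Φ)) ^ (1 / p) *
            (∫⁻ z, (ENNReal.ofReal (Real.exp (Ymod Φ F w β z))) ^ q ∂(localGibbsLaw σ a u₀ θ₀ N Φ)) ^ (1 / q) := by
          rw [hlaw]
          exact KineticWindowGronwallRenyiHolderTransfer.stub_renyiHolderTransfer σ N Φ _ hψm hψ0
            (fun _ => ENNReal.ofReal_ne_top) _ hHm _ p q hpq
      _ ≤ E ^ (1 / p) * E ^ (1 / q) :=
          mul_le_mul' (ENNReal.rpow_le_rpow (hR _ hs0 hs1) hpq.one_div_nonneg)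
            (ENNReal.rpow_le_rpow (hHq.trans_le hW) hpq.symm.one_div_nonneg)
      _ = E := by
          rw [← ENNReal.rpow_add_of_nonneg _ _ hpq.one_div_nonneg hpq.symm.one_div_nonneg,
            hpq.one_div_add_one_div, one_div_one, ENNReal.rpow_one]
  calc ewm σ a θ₀ u₀ N Φ F ((k : ℝ) * w) β
      = ∫⁻ z, ∏ j ∈ Finset.range k, ENNReal.ofReal (Real.exp (Ymod Φ F w β (Φ.flow ((j : ℝ) * w) z))) ^ (k : ℝ)⁻¹
          ∂(localGibbsLaw σ a u₀ θ₀ N Φ) := by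
        unfold ewm
        refine lintegral_congr_ae (hgood.mono fun z hz => ?_)
        dsimp only
        rw [window_cesaro_sum Φ hF hz w β k, ofReal_exp_inv_mul_sum]
    _ ≤ ∏ j ∈ Finset.range k, (∫⁻ z, ENNReal.ofReal (Real.exp (Ymod Φ F w β (Φ.flow ((j : ℝ) * w) z)))
          ∂(localGibbsLaw σ a u₀ θ₀ N Φ)) ^ (k : ℝ)⁻¹ :=
        ENNReal.lintegral_prod_norm_pow_le (Finset.range k)
          (f := fun j z => ENNReal.ofReal (Real.exp (Ymod Φ F w β (Φ.flow ((j : ℝ) * w) z))))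
          (fun j _ => (hHm.comp (Φ.measurable_flow _)).aemeasurable) hsum fun _ _ => hk0
    _ ≤ ∏ _j ∈ Finset.range k, E ^ (k : ℝ)⁻¹ :=
        Finset.prod_le_prod' fun j hj => ENNReal.rpow_le_rpow (hfac j hj) hk0
    _ = E := by
        rw [Finset.prod_const, Finset.card_range, ENNReal.rpow_inv_natCast_pow hk.ne']

/-! ### The number of sub-windows -/

/-- For `0 < τ₀ ≤ τ` there is `k ≥ 1` (namely `⌊τ/τ₀⌋₊`) with `τ/k ∈ [τ₀, 2τ₀]`. [folklore] -/
theorem exists_subwindows {τ₀ τ : ℝ} (hτ₀ : 0 < τ₀) (hτ : τ₀ ≤ τ) :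
    ∃ k : ℕ, 0 < k ∧ τ / k ∈ Icc τ₀ (2 * τ₀) := by
  have hx : 1 ≤ τ / τ₀ := by rwa [le_div_iff₀ hτ₀, one_mul]
  have hk : 0 < ⌊τ / τ₀⌋₊ := Nat.floor_pos.mpr hx
  have hkR : (0 : ℝ) < ⌊τ / τ₀⌋₊ := Nat.cast_pos.mpr hk
  have h1 : (⌊τ / τ₀⌋₊ : ℝ) ≤ τ / τ₀ := Nat.floor_le (zero_le_one.trans hx)
  have h2 : τ / τ₀ < ⌊τ / τ₀⌋₊ + 1 := Nat.lt_floor_add_one _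
  have h3 : (1 : ℝ) ≤ ⌊τ / τ₀⌋₊ := by exact_mod_cast hk
  rw [le_div_iff₀ hτ₀] at h1
  rw [div_lt_iff₀ hτ₀] at h2
  refine ⟨⌊τ / τ₀⌋₊, hk, ?_, ?_⟩
  · rw [le_div_iff₀ hkR]
    linarith
  · rw [div_le_iff₀ hkR]
    nlinarith

/-! ### The registered helper stub -/

/-- **Registered helper stub `stub_windowClauseOfRenyi`** (line `board-node-dock`, crux stmt-AtomisticToContinuum-9282):
`WindowClauseOfRenyi` holds — `k = ⌊τ/τ₀⌋₊` shifted sub-windows of parameter `τ/k ∈ [τ₀, 2τ₀]`, generalised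
Hölder, Rényi–Hölder transfer of each factor (`ewm_mul_le`), thresholds from (R) at `(τ, ε)` and (W) at
`(qβ, ε, τ/k)`. [folklore] -/
theorem stub_windowClauseOfRenyi : WindowClauseOfRenyi := by
  intro σ a θ₀ u₀ ha hθ hu ha0 hθ0 Φ F hF p q hpq hR b τ₀ hτ₀ hW β hβ ε hε τ hτ
  obtain ⟨k, hk, hτ'⟩ := exists_subwindows hτ₀ hτ
  have hkR : (k : ℝ) ≠ 0 := Nat.cast_ne_zero.mpr hk.ne'
  have hq : 0 < q := hpq.symm.pos
  have hqβ : |q * β| ≤ b := by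
    rw [abs_mul, abs_of_pos hq]
    calc q * |β| ≤ q * (b / q) := mul_le_mul_of_nonneg_left hβ hq.le
      _ = b := mul_div_cancel₀ _ hq.ne'
  obtain ⟨N₁, hN₁⟩ := hR τ ε (hτ₀.trans_le hτ) hε
  obtain ⟨N₂, hN₂⟩ := hW (q * β) hqβ ε hε (τ / k) hτ'
  refine ⟨max N₁ N₂, fun N hN => ?_⟩
  have hc : 0 < ((N : ℝ) + 1) ^ (-(1 / 3 : ℝ)) := Real.rpow_pos_of_pos (by positivity) _
  have hw : 0 ≤ τ / k * ((N : ℝ) + 1) ^ (-(1 / 3 : ℝ)) :=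
    mul_nonneg (div_nonneg (hτ₀.le.trans hτ) (Nat.cast_nonneg k)) hc.le
  have hkw : (k : ℝ) * (τ / k * ((N : ℝ) + 1) ^ (-(1 / 3 : ℝ))) = τ * ((N : ℝ) + 1) ^ (-(1 / 3 : ℝ)) := by
    rw [← mul_assoc, mul_div_cancel₀ _ hkR]
  rw [windowMoment_eq_ewm, ← hkw]
  refine ewm_mul_le ha hθ hu ha0 hθ0 (Φ N) hF hpq hk hw β (fun s hs0 hs1 => hN₁ N (le_of_max_le_left hN) s hs0 ?_) ?_
  · rwa [hkw] at hs1
  · rw [← windowMoment_eq_ewm]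
    exact hN₂ N (le_of_max_le_right hN)

end Summit.AtomisticToContinuum.HydrodynamicLimit.Theorems.KineticWindowGronwallWindowClauseOfRenyi

end
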